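import Summits.QuantumFields.GaugeBoot.RPBootstrapBoundsConvergenceZd
import Summits.QuantumFields.GaugeBoot.FullSpaceGroupCertificatesZd
import HarnessLib

/-!
# Certificates with reflection-positivity multipliers: sound for every thermodynamic limit point, complete for the reflection-positive symmetric phases (gauge-boot, L1/L4 supplement)

HONEST FRAMING (cell `pub-gaugeboot`, page 1 of every file): the venture produces certified bounds
on lattice expectations at stated coupling, gauge group, dimension and torus size; NOT a mass gap,
NOT a continuum limit, NOT a string tension; NOT Yang–Mills-summit-bearing (barriers
`FixedCouplingUltralocality`, `PerturbativeInvisibility`). Structural; it certifies no number.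

## Content (`SU(N)` on `ℤ^d`, word level `n`; `β ≥ 0` where existence of RP states is used)

The dual of the SDP with everything (`rpFullSymLevelValuesZdSuN`, `BootstrapRPCutsZd`): a certificate
for `P ≤ c` at level `n` is an identity
`c • 1 - P = Σ v_j² + Σ λ_l (rows) + Σ κ_m (w_m ∘ g_m - w_m) + Σ ν_k (F_k ∘ Θ_k) F_k`, `ν_k ≥ 0` —
SOS ⊕ loop equations ⊕ symmetry multipliers ⊕ REFLECTION-POSITIVITY MULTIPLIERS (`F_k` in a word
space at a site or link half-space, `Θ_k` the matching reflection) — the dual variables of the RP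
blocks of Kazakov–Zheng's SDP.

* `rpMultiplierConeZdSuN N n` (non-negative combinations of the degree-`n` cut observables), ★
  `rpFullCertConeZdSuN N β n = fullCertCone ⊔ rpMultiplierCone` — inside the certificate domain, `1`
  an order unit;
* ★ `isDualFeasible_rpFullCertCone_iff_suN` — dual feasibility = the data of `rpFullSymLevelValuesZdSuN`;
* ★★ SOUNDNESS `le_of_mem_rpFullCertCone_suN`; ★★★ `limitPoint_integral_le_of_mem_rpFullCertCone_suN`
  — `β ≥ 0`: A CERTIFICATE WITH RP MULTIPLIERS AT ANY LEVEL BOUNDS `∫ P dμ` FOR EVERY THERMODYNAMIC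
  LIMIT POINT `μ` OF THE TORUS WILSON STATES (and every RP fully symmetric Gibbs state);
* ★★★ NO GAP (`β ≥ 0`) `forall_rpFullSymLevelValuesZd_le_iff_suN`, `exists_rpFullCertificate_suN`
  (explicit `σ + ρ + δ + κ`), `sSup_rpFullSymLevelValuesZd_eq_sInf_suN`;
* ★★★ COMPLETENESS (`β ≥ 0`) `exists_rpFullCertificate_of_forall_rpDlr_le_suN` — a polynomial bound
  strictly valid in every reflection-positive fully symmetric Gibbs state has a certificate with RP
  multipliers at some level. The ladder: plain ⟷ all Gibbs states; + translation multipliers ⟷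
  homogeneous; + all symmetry multipliers ⟷ fully symmetric; + RP multipliers ⟷ RP fully symmetric.

References: V. Kazakov, Z. Zheng, arXiv:2203.11360, arXiv:2404.16925 (dual of the RP blocks);
K. Osterwalder, E. Seiler, Ann. Phys. 110 (1978) 440. Folklore.
-/

noncomputable section

open MeasureTheory Filter Topology NormedSpace
open scoped ComplexOrder
open Literature.MathematicalPhysics.QuantumFieldTheory (LatticeRep)
open Literature.MathematicalPhysics.QuantumLattice

namespace Summit.QuantumFields.GaugeBoot

open OrderUnitDuality

section ZdSuN

variable {d : ℕ} (N : ℕ) (β : ℝ)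

/-- **The reflection-positivity multipliers' cone**: non-negative combinations of the degree-`n` cut
observables `(F ∘ Θ) F`. [folklore] -/
def rpMultiplierConeZdSuN (n : ℕ) : PointedCone ℝ C(LGConfig d (Matrix.specialUnitaryGroup (Fin N) ℂ), ℝ) :=
  Submodule.span {c : ℝ // 0 ≤ c} (rpCutObservablesZd (d := d) N n)

/-- ★ **The certificate cone with everything**: SOS ⊕ rows ⊕ symmetry multipliers ⊕ RP multipliers. -/
def rpFullCertConeZdSuN (n : ℕ) : PointedCone ℝ C(LGConfig d (Matrix.specialUnitaryGroup (Fin N) ℂ), ℝ) :=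
  fullCertConeZdSuN (d := d) N β n ⊔ rpMultiplierConeZdSuN (d := d) N n

/-- The symmetry-multiplier cone sits inside. -/
theorem fullCertCone_le_rpFullCertCone_suN (n : ℕ) :
    fullCertConeZdSuN (d := d) N β n ≤ rpFullCertConeZdSuN (d := d) N β n := le_sup_left

/-- Cut observables are certificates (of `0 ≤ (F∘Θ)F`). -/
theorem mem_rpFullCertCone_of_mem_rpCutObservables_suN {n : ℕ}
    {b : C(LGConfig d (Matrix.specialUnitaryGroup (Fin N) ℂ), ℝ)} (hb : b ∈ rpCutObservablesZd (d := d) N n) :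
    b ∈ rpFullCertConeZdSuN (d := d) N β n :=
  Submodule.mem_sup_right (Submodule.subset_span hb)

/-- The cut observables lie in the words of length `≤ 2n`. -/
theorem rpCutObservablesZd_subset_wordTruncation (n : ℕ) :
    ∀ b ∈ rpCutObservablesZd (d := d) N n,
      b ∈ wordTruncation (ι := ZdEdge d) (fundamentalLatticeRep N) (n + n) := by
  rintro b (⟨i, F, hF, rfl⟩ | ⟨i, F, hF, rfl⟩)
  · have hFn := mem_wordTruncation_of_mem_wordSpace (fundamentalLatticeRep N) hF
    exact mul_mem_wordTruncation_add _ (comp_zdSiteReflectCM_mem_wordTruncation i _ n hFn) hFn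
  · have hFn := mem_wordTruncation_of_mem_wordSpace (fundamentalLatticeRep N) hF
    refine mul_mem_wordTruncation_add _ ?_ hFn
    rw [comp_zdLinkReflectCM]
    exact comp_relabelCM_mem_wordTruncation _ _ (comp_zdSiteReflectCM_mem_wordTruncation i _ n hFn)

/-- The RP multipliers' cone lies in the words of length `≤ 2n`. -/
theorem rpMultiplierCone_le_wordTruncation_suN (n : ℕ) :
    ∀ x ∈ rpMultiplierConeZdSuN (d := d) N n, x ∈ wordTruncation (ι := ZdEdge d) (fundamentalLatticeRep N) (n + n) := by
  intro x hx
  induction hx using Submodule.span_induction with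
  | mem y hy => exact rpCutObservablesZd_subset_wordTruncation N n y hy
  | zero => exact (Submodule.span ℝ _).zero_mem
  | add y z _ _ hy hz => exact (Submodule.span ℝ _).add_mem hy hz
  | smul c y _ hy => exact (Submodule.span ℝ _).smul_mem (c : ℝ) hy

/-- **The cone with everything lives in the certificate domain.** -/
theorem rpFullCertCone_le_certDomain_suN (n : ℕ) :
    ∀ x ∈ rpFullCertConeZdSuN (d := d) N β n, x ∈ certDomainZdSuN (d := d) N β n := by
  intro x hx
  obtain ⟨y, hy, z, hz, rfl⟩ := Submodule.mem_sup.1 hx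
  exact (certDomainZdSuN (d := d) N β n).add_mem (fullCertCone_le_certDomain_suN N β n y hy)
    (mem_certDomain_of_mem_wordTruncation _ (rpMultiplierCone_le_wordTruncation_suN N n z hz))

/-- `1` is a certificate and an order unit for the cone with everything on the certificate domain. -/
theorem rpFullCertCone_orderUnit_suN (n : ℕ) :
    (1 : C(LGConfig d (Matrix.specialUnitaryGroup (Fin N) ℂ), ℝ)) ∈ rpFullCertConeZdSuN (d := d) N β n ∧
      ∀ x ∈ certDomainZdSuN (d := d) N β n, ∃ t : ℝ,
        t • (1 : C(LGConfig d (Matrix.specialUnitaryGroup (Fin N) ℂ), ℝ)) - x ∈ rpFullCertConeZdSuN (d := d) N β n :=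
  ⟨fullCertCone_le_rpFullCertCone_suN N β n (fullCertCone_orderUnit_suN N β n).1, fun x hx => by
    obtain ⟨t, ht⟩ := (fullCertCone_orderUnit_suN N β n).2 x hx
    exact ⟨t, fullCertCone_le_rpFullCertCone_suN N β n ht⟩⟩

/-! ### Dual feasibility = the data with everything -/

/-- A functional non-negative on the degree-`n` cut observables is non-negative on the RP
multipliers' cone. -/
theorem nonneg_of_mem_rpMultiplierCone_suN {n : ℕ}
    {φ : C(LGConfig d (Matrix.specialUnitaryGroup (Fin N) ℂ), ℝ) →ₗ[ℝ] ℝ}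
    (h : ∀ b ∈ rpCutObservablesZd (d := d) N n, 0 ≤ φ b)
    {x : C(LGConfig d (Matrix.specialUnitaryGroup (Fin N) ℂ), ℝ)} (hx : x ∈ rpMultiplierConeZdSuN (d := d) N n) :
    0 ≤ φ x := by
  induction hx using Submodule.span_induction with
  | mem y hy => exact h y hy
  | zero => simp
  | add y z _ _ hy hz => rw [map_add]; exact add_nonneg hy hz
  | smul c y _ hy =>
    rw [show (c • y : C(LGConfig d (Matrix.specialUnitaryGroup (Fin N) ℂ), ℝ)) = (c : ℝ) • y from rfl, map_smul,
      smul_eq_mul]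
    exact mul_nonneg c.2 hy

/-- ★ **Dual feasibility for the cone with everything is exactly the data of
`rpFullSymLevelValuesZdSuN`.** [folklore] -/
theorem isDualFeasible_rpFullCertCone_iff_suN {n : ℕ}
    {φ : C(LGConfig d (Matrix.specialUnitaryGroup (Fin N) ℂ), ℝ) →ₗ[ℝ] ℝ} :
    IsDualFeasible (rpFullCertConeZdSuN (d := d) N β n) 1 φ ↔
      (IsBootstrapFeasible (fundamentalLatticeRep N) (suExp N)
          (fun e => wilsonBoundaryAction (fundamentalRep (Fin N)) {e}) β
          (wordTruncation (ι := ZdEdge d) (fundamentalLatticeRep N) n) φ ∧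
        ∀ R ∈ fullSpaceGroupMaps d N, ∀ w ∈ wordTruncation (ι := ZdEdge d) (fundamentalLatticeRep N) (n + n),
          φ (w.comp R) = φ w) ∧
      IsSiteRPCutFunctional (fundamentalLatticeRep N) n φ ∧ IsLinkRPCutFunctional (fundamentalLatticeRep N) n φ := by
  constructor
  · rintro ⟨hpos, h1⟩
    refine ⟨(isDualFeasible_fullCertCone_iff_suN N β).1 ⟨fun x hx => hpos x
      (fullCertCone_le_rpFullCertCone_suN N β n hx), h1⟩, fun i F hF => ?_, fun i F hF => ?_⟩
    · exact hpos _ (mem_rpFullCertCone_of_mem_rpCutObservables_suN N β (Or.inl ⟨i, F, hF, rfl⟩))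
    · exact hpos _ (mem_rpFullCertCone_of_mem_rpCutObservables_suN N β (Or.inr ⟨i, F, hF, rfl⟩))
  · rintro ⟨hfull, hsite, hlink⟩
    obtain ⟨hpos, h1⟩ := (isDualFeasible_fullCertCone_iff_suN N β).2 hfull
    refine ⟨fun x hx => ?_, h1⟩
    obtain ⟨y, hy, z, hz, rfl⟩ := Submodule.mem_sup.1 hx
    rw [map_add]
    exact add_nonneg (hpos y hy)
      (nonneg_of_mem_rpMultiplierCone_suN N (nonneg_of_mem_rpCutObservablesZd N hsite hlink) hz)

/-- The values with everything as the values of the dual-feasible functionals of the cone. -/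
theorem rpFullSymLevelValuesZd_eq_setOf_isDualFeasible_suN (n : ℕ)
    (P : C(LGConfig d (Matrix.specialUnitaryGroup (Fin N) ℂ), ℝ)) :
    rpFullSymLevelValuesZdSuN (d := d) N β n P =
      {t | ∃ φ : C(LGConfig d (Matrix.specialUnitaryGroup (Fin N) ℂ), ℝ) →ₗ[ℝ] ℝ,
        IsDualFeasible (rpFullCertConeZdSuN (d := d) N β n) 1 φ ∧ φ P = t} := by
  ext t
  constructor
  · rintro ⟨φ, hφ, hT, hperm, hrefl, hsite, hlink, rfl⟩
    exact ⟨φ, (isDualFeasible_rpFullCertCone_iff_suN N β).2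
      ⟨⟨hφ, (forall_fullSpaceGroupMaps_iff N).2 ⟨hT, hperm, hrefl⟩⟩, hsite, hlink⟩, rfl⟩
  · rintro ⟨φ, hφ, rfl⟩
    obtain ⟨⟨h1, h2⟩, hsite, hlink⟩ := (isDualFeasible_rpFullCertCone_iff_suN N β).1 hφ
    obtain ⟨hT, hperm, hrefl⟩ := (forall_fullSpaceGroupMaps_iff N).1 h2
    exact ⟨φ, h1, hT, hperm, hrefl, hsite, hlink, rfl⟩

/-- A dual-feasible functional for the cone with everything exists (`β ≥ 0`). -/
theorem exists_isDualFeasible_rpFullCertCone_suN [NeZero d] {β : ℝ} (hβ : 0 ≤ β) (n : ℕ) :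
    ∃ φ : C(LGConfig d (Matrix.specialUnitaryGroup (Fin N) ℂ), ℝ) →ₗ[ℝ] ℝ,
      IsDualFeasible (rpFullCertConeZdSuN (d := d) N β n) 1 φ := by
  obtain ⟨t, ht⟩ := rpFullSymLevelValuesZd_nonempty (d := d) N hβ n 1
  rw [rpFullSymLevelValuesZd_eq_setOf_isDualFeasible_suN] at ht
  obtain ⟨φ, hφ, -⟩ := ht
  exact ⟨φ, hφ⟩

/-! ### Soundness -/

/-- ★★ **A certificate with RP multipliers bounds every value of the SDP with everything.** -/
theorem le_of_mem_rpFullCertCone_suN {n : ℕ} {P : C(LGConfig d (Matrix.specialUnitaryGroup (Fin N) ℂ), ℝ)} {c : ℝ}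
    (hc : c • (1 : C(LGConfig d (Matrix.specialUnitaryGroup (Fin N) ℂ), ℝ)) - P ∈ rpFullCertConeZdSuN (d := d) N β n) :
    ∀ t ∈ rpFullSymLevelValuesZdSuN (d := d) N β n P, t ≤ c := by
  intro t ht
  rw [rpFullSymLevelValuesZd_eq_setOf_isDualFeasible_suN] at ht
  obtain ⟨φ, hφ, rfl⟩ := ht
  exact hφ.le_of_mem_certLevels hc

/-- ★★ **A certificate with RP multipliers bounds every reflection-positive fully symmetric Gibbs
state.** -/
theorem rpDlr_integral_le_of_mem_rpFullCertCone_suN {n : ℕ}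
    {P : C(LGConfig d (Matrix.specialUnitaryGroup (Fin N) ℂ), ℝ)} {c : ℝ}
    (hc : c • (1 : C(LGConfig d (Matrix.specialUnitaryGroup (Fin N) ℂ), ℝ)) - P ∈ rpFullCertConeZdSuN (d := d) N β n) :
    ∀ t ∈ rpDlrValuesSuN (d := d) N β P, t ≤ c := fun t ht =>
  le_of_mem_rpFullCertCone_suN N β hc t (rpDlrValues_subset_rpFullSymLevelValuesZd_suN N β n P ht)

/-- ★★★ **A certificate with RP multipliers bounds every thermodynamic limit point of the torus
Wilson states** (`β ≥ 0`). [folklore] -/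
theorem limitPoint_integral_le_of_mem_rpFullCertCone_suN [NeZero d] {β : ℝ} (hβ : 0 ≤ β) {n : ℕ}
    {P : C(LGConfig d (Matrix.specialUnitaryGroup (Fin N) ℂ), ℝ)} {c : ℝ}
    (hc : c • (1 : C(LGConfig d (Matrix.specialUnitaryGroup (Fin N) ℂ), ℝ)) - P ∈ rpFullCertConeZdSuN (d := d) N β n)
    {μ : Measure (LGConfig d (Matrix.specialUnitaryGroup (Fin N) ℂ))}
    (hμ : μ ∈ infiniteVolumeLimitPoints (d := d) (fundamentalRep (Fin N)) β) : ∫ U, P U ∂μ ≤ c :=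
  le_of_mem_rpFullCertCone_suN N β hc _
    (integral_mem_rpFullSymLevelValuesZd_of_mem_infiniteVolumeLimitPoints N hβ hμ n P)

/-! ### Completeness at a fixed level (`β ≥ 0`) -/

/-- ★★★ **No duality gap for the SDP with everything** (`β ≥ 0`, `P` in the level-`n` certificate
domain). [folklore] -/
theorem forall_rpFullSymLevelValuesZd_le_iff_suN [NeZero d] {β : ℝ} (hβ : 0 ≤ β) {n : ℕ}
    {P : C(LGConfig d (Matrix.specialUnitaryGroup (Fin N) ℂ), ℝ)} (hP : P ∈ certDomainZdSuN (d := d) N β n)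
    {c : ℝ} :
    (∀ t ∈ rpFullSymLevelValuesZdSuN (d := d) N β n P, t ≤ c) ↔
      ∀ ε : ℝ, 0 < ε → (c + ε) • (1 : C(LGConfig d (Matrix.specialUnitaryGroup (Fin N) ℂ), ℝ)) - P ∈
        rpFullCertConeZdSuN (d := d) N β n := by
  have h := forall_apply_le_iff (certDomainZdSuN (d := d) N β n) (rpFullCertCone_le_certDomain_suN N β n)
    (rpFullCertCone_orderUnit_suN N β n).1 (rpFullCertCone_orderUnit_suN N β n).2
    (exists_isDualFeasible_rpFullCertCone_suN N hβ n) hP (c := c)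
  rw [← h, rpFullSymLevelValuesZd_eq_setOf_isDualFeasible_suN]
  constructor
  · intro h' φ hφ
    exact h' _ ⟨φ, hφ, rfl⟩
  · rintro h' t ⟨φ, hφ, rfl⟩
    exact h' φ hφ

/-- ★★★ **Explicit certificates with RP multipliers** (`β ≥ 0`): every constant strictly above the
maximum of the SDP with everything has `c' • 1 - P = σ + ρ + δ + κ` with `σ` SOS, `ρ` rows, `δ`
symmetry multipliers and `κ` a non-negative combination of cut observables `(F ∘ Θ) F`. [folklore] -/
theorem exists_rpFullCertificate_suN [NeZero d] {β : ℝ} (hβ : 0 ≤ β) {n : ℕ}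
    {P : C(LGConfig d (Matrix.specialUnitaryGroup (Fin N) ℂ), ℝ)} (hP : P ∈ certDomainZdSuN (d := d) N β n)
    {c c' : ℝ} (h : ∀ t ∈ rpFullSymLevelValuesZdSuN (d := d) N β n P, t ≤ c) (hc : c < c') :
    ∃ σ ∈ sosCone (wordTruncation (ι := ZdEdge d) (fundamentalLatticeRep N) n),
      ∃ ρ ∈ rowSpace (fundamentalLatticeRep N) (suExp N)
        (fun e => wilsonBoundaryAction (fundamentalRep (Fin N)) {e}) β
        (wordTruncation (ι := ZdEdge d) (fundamentalLatticeRep N) n),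
      ∃ δ ∈ spaceGroupDiffZdSuN (d := d) N n, ∃ κ ∈ rpMultiplierConeZdSuN (d := d) N n,
        σ + ρ + δ + κ = c' • (1 : C(LGConfig d (Matrix.specialUnitaryGroup (Fin N) ℂ), ℝ)) - P := by
  have h' := (forall_rpFullSymLevelValuesZd_le_iff_suN N hβ hP).1 h (c' - c) (sub_pos.2 hc)
  rw [add_sub_cancel] at h'
  obtain ⟨y, hy, κ, hκ, hsum⟩ := Submodule.mem_sup.1 h'
  obtain ⟨y', hy', δ, hδ, rfl⟩ := Submodule.mem_sup.1 hy
  obtain ⟨σ, hσ, ρ, hρ, rfl⟩ := (mem_certCone_iff (fundamentalLatticeRep N)).1 hy'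
  rw [Submodule.restrictScalars_mem] at hδ
  exact ⟨σ, hσ, ρ, hρ, δ, hδ, κ, hκ, hsum⟩

/-- ★★ **The maximum of the SDP with everything equals the infimum of its certified constants**
(`β ≥ 0`). -/
theorem sSup_rpFullSymLevelValuesZd_eq_sInf_suN [NeZero d] {β : ℝ} (hβ : 0 ≤ β) {n : ℕ}
    {P : C(LGConfig d (Matrix.specialUnitaryGroup (Fin N) ℂ), ℝ)} (hP : P ∈ certDomainZdSuN (d := d) N β n) :
    sSup (rpFullSymLevelValuesZdSuN (d := d) N β n P) =
      sInf {c : ℝ | c • (1 : C(LGConfig d (Matrix.specialUnitaryGroup (Fin N) ℂ), ℝ)) - P ∈ rpFullCertConeZdSuN (d := d) N β n} := by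
  rw [rpFullSymLevelValuesZd_eq_setOf_isDualFeasible_suN]
  exact sSup_eq_sInf (certDomainZdSuN (d := d) N β n) (rpFullCertCone_le_certDomain_suN N β n)
    (rpFullCertCone_orderUnit_suN N β n).1 (rpFullCertCone_orderUnit_suN N β n).2
    (exists_isDualFeasible_rpFullCertCone_suN N hβ n) hP

/-! ### Completeness for the reflection-positive symmetric phases (`β ≥ 0`) -/

/-- ★★★ **Every polynomial bound strictly valid in all reflection-positive fully symmetric Gibbs states
has a certificate with RP multipliers at some level** (`SU(N)` on `ℤ^d`, `β ≥ 0`). [folklore] -/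
theorem exists_rpFullCertificate_of_forall_rpDlr_le_suN [NeZero d] {β : ℝ} (hβ : 0 ≤ β)
    {P : C(LGConfig d (Matrix.specialUnitaryGroup (Fin N) ℂ), ℝ)}
    (hP : P ∈ polyAlgebra (ι := ZdEdge d) (fundamentalLatticeRep N)) {c₀ c : ℝ}
    (h : ∀ t ∈ rpDlrValuesSuN (d := d) N β P, t ≤ c₀) (hc : c₀ < c) :
    ∃ n, c • (1 : C(LGConfig d (Matrix.specialUnitaryGroup (Fin N) ℂ), ℝ)) - P ∈ rpFullCertConeZdSuN (d := d) N β n := by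
  obtain ⟨hIne, hIbdd, -⟩ := rpDlrValues_nonempty_bdd_suN (d := d) N hβ P
  have hS : sSup (rpDlrValuesSuN (d := d) N β P) ≤ c₀ := csSup_le hIne h
  have hlt : sSup (rpDlrValuesSuN (d := d) N β P) < (c₀ + c) / 2 := by linarith
  have hev := (tendsto_sSup_rpFullSymLevelValuesZd_suN N hβ hP).eventually (Iio_mem_nhds hlt)
  obtain ⟨n, hn₁, hn₂⟩ := (hev.and (eventually_mem_certDomainZd_suN N β hP)).exists
  obtain ⟨hbdd, -, -⟩ := bdd_rpFullSymLevelValuesZd_suN N hβ hn₂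
  refine ⟨n, ?_⟩
  have hle : ∀ t ∈ rpFullSymLevelValuesZdSuN (d := d) N β n P, t ≤ (c₀ + c) / 2 := fun t ht =>
    (le_csSup hbdd ht).trans (le_of_lt hn₁)
  have h' := (forall_rpFullSymLevelValuesZd_le_iff_suN N hβ hn₂).1 hle (c - (c₀ + c) / 2) (by linarith)
  rwa [add_sub_cancel] at h'

end ZdSuN

end Summit.QuantumFields.GaugeBoot

end
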